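import Literature.NumberTheory.Automorphic.UnitaryGroupTruncationFiniteSum
import HarnessLib

/-!
# «The sums over `δ` are finite» for `U(J₂)`: only finitely many `δ ∈ B(F)\G(F)` have `H(δ x) > T`,
# so Arthur's truncation `Λ^T φ` and truncated kernel `k^T` are honest finite sums in two variables
(Rogawski, *Automorphic Representations of Unitary Groups in Three Variables* (1990), §2.2, p. 13:
«The sums over `δ` and `γ` in the definition of `k^T(x)` are finite» — stated for the rank-one groups
`U(3)`, `U(2)`, `U(2) × U(1)` of §7.3 p. 98; Garrett, *Modern Analysis of Automorphic Forms by Example*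
(2018), §2.2–§2.3 (reduction theory via heights), §2.10.)

Topic `NumberTheory/Automorphic`; namespace `Literature.NumberTheory.Automorphic.UnitaryGroup`. THEOREMS ONLY
over accepted tree modules: no definition, no named fact, no `sorry`, no instance, no notation. The `N = 2`
sibling of §§2–3 of ★ `UnitaryGroupTruncationFiniteSum` (whose §1 Northcott finiteness
★ `finite_setOf_vecHeight_ratVec_vecMul_le` and §4 threshold `borelHeight_rational_mul_le` are every-`N` and
USED here); H-SIDE copy of LAWS 1–5 (`H = U(Φ₂) × U(Φ₁)`, LEAD WORDs #123∕#124, census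
`CENSUS-LAWS-Hside.F0P3a-p03g6.md` §3 LAW 1∕LAW 3) of the T1 line `Cruxes/H413/Lines/F0_T1InnerFormTraceIdentity.lean`
(cell `pub/hodgecm-mathlib`, crux H413).

* §2 (`U(J₂)`, `F`-rank one). For `γ ∈ G(F) = U(J₂)(F)` the last row `e₂ γ` is a non-zero rational vector
  whose line `[e₂ γ] ∈ ℙ¹(E)` depends only on the coset `B(F) γ`, and **`B(F) γ ↦ [e₂ γ]` is INJECTIVE**
  (`mem_borelAdelic_toAdelic_of_lastRow_eq_smul_two`: a `2 × 2` matrix whose last row is `(0, a)` IS upper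
  triangular; `rightRel_of_lastRow_eq_smul_two`).
* §3 Hence **`finite_setOf_lt_borelHeight_two`**: for `x ∈ G(𝔸_F)` and `T > 0` the set
  `{δ ∈ B(F)\G(F) : H(δ x) > T}` is FINITE; consequently the pseudo-Eisenstein sums defining ★ `truncation`
  (`Λ^T φ`) and ★ `truncatedKernel` (`k^T`) have FINITE support (`finite_support_constantTermTail_translate_two`,
  `finite_support_kernelBorelTail_translate_two`) and the `finsum`s are genuine finite sums
  (`truncation_eq_sub_sum_two`, `truncatedKernel_eq_sub_sum_two`).

## References

* J. D. Rogawski, *Automorphic Representations of Unitary Groups in Three Variables*, Annals of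
  Mathematics Studies 123 (1990), §2.2 (p. 13), §7.3 (p. 98) [Rogawski1990].
* P. Garrett, *Modern Analysis of Automorphic Forms by Example* (2018), §2.2 (heights on `GL_n`,
  Thm. 2.2.2), §2.3 (reduction: finitely many `γ` with large height), §2.10 (`Λ^T`) [Garrett2018].
-/

set_option autoImplicit false

noncomputable section

open MeasureTheory NumberField IsDedekindDomain Matrix
open scoped NNReal ENNReal MatrixGroups

namespace Literature.NumberTheory.Automorphic

namespace UnitaryGroup

variable {F E : Type} [Field F] [NumberField F] [Field E] [NumberField E] [Algebra F E]
  {c : E ≃ₐ[F] E}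

/-! ## §2 `U(J₂)`: the last row of a rational element and the injection `B(F)\G(F) ↪ ℙ¹(E)` -/

/-- **A rational matrix of `U(J₂)` whose last row is `(0, a)` is upper triangular**, i.e. its adelic image lies
in `B(𝔸_F)`: for `2 × 2` matrices upper triangularity IS the vanishing of the entry `(1, 0)`, which is the
hypothesis. (For `N = 3` — ★ `mem_borelAdelic_toAdelic_of_lastRow_eq_smul` — one more entry has to be killed via
the unitary inverse; here nothing unitary is needed.) The stabiliser of the isotropic line `E e₂` is the Borel
subgroup (Rogawski (1990), §1.10). [cite: Rogawski1990, §1.10] -/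
theorem mem_borelAdelic_toAdelic_of_lastRow_eq_smul_two {γ : (quasiSplit F E c 2).Rational} {a : E}
    (h : (fun j : Fin 2 => ((γ.1 : GL (Fin 2) E) : Matrix (Fin 2) (Fin 2) E) ⊤ j) = a • Pi.single (⊤ : Fin 2) (1 : E)) :
    (quasiSplit F E c 2).toAdelic γ ∈ borelAdelic F E c 2 := by
  set A : Matrix (Fin 2) (Fin 2) E := ((γ.1 : GL (Fin 2) E) : Matrix (Fin 2) (Fin 2) E) with hA
  have htop : (⊤ : Fin 2) = 1 := rfl
  -- the given zero of the last row
  have h10 : A 1 0 = 0 := by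
    have := congrFun h 0; rw [htop] at this
    simpa using this
  -- upper triangularity of the adelic image
  rw [mem_borelAdelic_iff]
  intro i j hij
  change algebraMap E (AdeleRing (𝓞 E) E) (A i j) = 0
  have hz : A i j = 0 := by
    fin_cases i <;> fin_cases j <;> simp_all (config := {decide := true})
  rw [hz, map_zero]

/-- **Injectivity of `B(F) γ ↦ [e₂ γ] ∈ ℙ¹(E)`**: if `e₂ γ' = a · e₂ γ` (`a ∈ Eˣ`) then `γ' γ⁻¹` has last row
`a · e₂`, hence lies in `B(F)` (`mem_borelAdelic_toAdelic_of_lastRow_eq_smul_two`), so `B(F) γ = B(F) γ'` —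
Garrett's parametrisation of `P(F)\G(F)` by rational isotropic lines, the index set of the pseudo-Eisenstein
sums. [cite: Garrett2018, §2.2 (PDF p. 83)] -/
theorem rightRel_of_lastRow_eq_smul_two {γ γ' : (quasiSplit F E c 2).Rational} {a : Eˣ}
    (h : (fun j : Fin 2 => ((γ'.1 : GL (Fin 2) E) : Matrix (Fin 2) (Fin 2) E) ⊤ j) =
      (a : E) • fun j : Fin 2 => ((γ.1 : GL (Fin 2) E) : Matrix (Fin 2) (Fin 2) E) ⊤ j) :
    (quasiSplit F E c 2).toAdelic (γ' * γ⁻¹) ∈ borelAdelic F E c 2 := by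
  refine mem_borelAdelic_toAdelic_of_lastRow_eq_smul_two (a := (a : E)) ?_
  -- last row of `γ' γ⁻¹` is `(e₂ γ') ᵥ* γ⁻¹ = a • (e₂ γ ᵥ* γ⁻¹) = a • e₂`
  funext j
  have hrow : (fun k : Fin 2 => (((γ' * γ⁻¹ : (quasiSplit F E c 2).Rational).1 : GL (Fin 2) E) :
      Matrix (Fin 2) (Fin 2) E) ⊤ k) =
      (fun k : Fin 2 => ((γ'.1 : GL (Fin 2) E) : Matrix (Fin 2) (Fin 2) E) ⊤ k) ᵥ*
        (((γ.1 : GL (Fin 2) E)⁻¹ : GL (Fin 2) E) : Matrix (Fin 2) (Fin 2) E) := by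
    funext k
    change (((γ'.1 * γ.1⁻¹ : GL (Fin 2) E)) : Matrix (Fin 2) (Fin 2) E) ⊤ k = _
    rw [Units.val_mul, Matrix.mul_apply, Matrix.vecMul, dotProduct]
  have hid : (fun k : Fin 2 => ((γ.1 : GL (Fin 2) E) : Matrix (Fin 2) (Fin 2) E) ⊤ k) ᵥ*
      (((γ.1 : GL (Fin 2) E)⁻¹ : GL (Fin 2) E) : Matrix (Fin 2) (Fin 2) E) = Pi.single (⊤ : Fin 2) 1 := by
    funext k
    have := congrFun (congrFun (show ((γ.1 : GL (Fin 2) E) : Matrix (Fin 2) (Fin 2) E) *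
      (((γ.1 : GL (Fin 2) E)⁻¹ : GL (Fin 2) E) : Matrix (Fin 2) (Fin 2) E) = 1 by
        rw [← Units.val_mul, mul_inv_cancel, Units.val_one]) ⊤) k
    rw [Matrix.mul_apply] at this
    rw [Matrix.vecMul, dotProduct, this, Matrix.one_apply, Pi.single_apply]
    simp only [eq_comm]
  rw [show (((γ' * γ⁻¹ : (quasiSplit F E c 2).Rational).1 : GL (Fin 2) E) : Matrix (Fin 2) (Fin 2) E) ⊤ j =
      (fun k : Fin 2 => (((γ' * γ⁻¹ : (quasiSplit F E c 2).Rational).1 : GL (Fin 2) E) :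
        Matrix (Fin 2) (Fin 2) E) ⊤ k) j from rfl, hrow, h, Matrix.smul_vecMul, hid]

/-! ## §3 Finiteness of `{δ ∈ B(F)\G(F) : H(δ x) > T}` and of the pseudo-Eisenstein sums -/

/-- **«The sums over `δ` are finite»** for `U(J₂)`: for `x ∈ U(J₂)(𝔸_F)` and `T > 0` only finitely many cosets
`δ ∈ B(F)\G(F)` have `H(δ x) > T`. Proof: `H(δ x) = h(e₂ δ · x)⁻¹` (★ `borelHeight`, ★ `lastRow_mul`),
`δ ↦ [e₂ δ] ∈ ℙ¹(E)` is injective on `B(F)\G(F)` (§2), and only finitely many rational lines have `h([ξ] x) ≤ T⁻¹`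
(★ `finite_setOf_vecHeight_ratVec_vecMul_le`, Northcott via the height zeta function). (Rogawski (1990), §2.2 p.
13, §7.3 p. 98; Garrett (2018), §2.3: reduction theory.) [cite: Rogawski1990, §2.2 (p. 13)] -/
theorem finite_setOf_lt_borelHeight_two (x : (quasiSplit F E c 2).Adelic) {T : ℝ≥0} (hT : 0 < T) :
    {q : Quotient (QuotientGroup.rightRel (arithmeticBorel F E c 2)) |
      T < borelHeight (((q.out : (quasiSplit F E c 2).arithmeticSubgroup) : (quasiSplit F E c 2).Adelic) * x)}.Finite := by
  classical
  -- rational representatives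
  have hrep : ∀ δ : (quasiSplit F E c 2).arithmeticSubgroup,
      ∃ γ : (quasiSplit F E c 2).Rational, (quasiSplit F E c 2).toAdelic γ = δ := fun δ => δ.2
  choose ρ hρ using hrep
  let row : (quasiSplit F E c 2).Rational → Fin 2 → E :=
    fun γ j => ((γ.1 : GL (Fin 2) E) : Matrix (Fin 2) (Fin 2) E) ⊤ j
  have hrow0 : ∀ γ, row γ ≠ 0 := fun γ => lastRow_rational_ne_zero γ
  -- the line map `q ↦ [e₂ ρ(q.out)]`
  let ℓ : Quotient (QuotientGroup.rightRel (arithmeticBorel F E c 2)) → Projectivization E (Fin 2 → E) :=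
    fun q => Projectivization.mk E (row (ρ q.out)) (hrow0 _)
  -- injectivity
  have hinj : Function.Injective ℓ := by
    intro q q' hqq
    obtain ⟨a, ha⟩ := (Projectivization.mk_eq_mk_iff E _ _ (hrow0 _) (hrow0 _)).1 hqq
    -- `ha : a • row (ρ q'.out) = row (ρ q.out)`
    have hB : (quasiSplit F E c 2).toAdelic (ρ q.out * (ρ q'.out)⁻¹) ∈ borelAdelic F E c 2 :=
      rightRel_of_lastRow_eq_smul_two (γ := ρ q'.out) (γ' := ρ q.out) (a := a) (by
        funext j; exact (congrFun ha j).symm)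
    have hmem : q.out * q'.out⁻¹ ∈ arithmeticBorel F E c 2 := by
      rw [mem_arithmeticBorel_iff, Subgroup.coe_mul, Subgroup.coe_inv, ← hρ q.out, ← hρ q'.out,
        ← map_inv, ← map_mul]
      exact hB
    have hmem' : q'.out * q.out⁻¹ ∈ arithmeticBorel F E c 2 := by
      have h' := Subgroup.inv_mem _ hmem
      rwa [_root_.mul_inv_rev, inv_inv] at h'
    rw [← Quotient.out_eq q, ← Quotient.out_eq q']
    exact Quotient.sound (QuotientGroup.rightRel_apply.2 hmem')
  -- heights: `H(q.out x) = h([ℓ q] x)⁻¹`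
  set g : GL (Fin 2) (AdeleRing (𝓞 E) E) := adelicVal F E c 2 _ x with hg
  have hH : ∀ q : Quotient (QuotientGroup.rightRel (arithmeticBorel F E c 2)),
      vecHeight E (ratVec E (ℓ q).rep ᵥ* (g : Matrix (Fin 2) (Fin 2) (AdeleRing (𝓞 E) E))) =
        (borelHeight (((q.out : (quasiSplit F E c 2).arithmeticSubgroup) : (quasiSplit F E c 2).Adelic) * x))⁻¹ := by
    intro q
    obtain ⟨u, hu⟩ := Projectivization.exists_smul_eq_mk_rep E (row (ρ q.out)) (hrow0 _)
    have hrat : ratVec E (ℓ q).rep = algebraMap E (AdeleRing (𝓞 E) E) (u : E) • principalVec E (row (ρ q.out)) := by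
      funext j
      change algebraMap E (AdeleRing (𝓞 E) E) ((ℓ q).rep j) = _
      rw [← hu, Pi.smul_apply, Pi.smul_apply, principalVec_apply, smul_eq_mul, Units.smul_def, smul_eq_mul,
        map_mul]
    rw [borelHeight_def, inv_inv, ← hρ q.out, lastRow_mul, lastRow_toAdelic, hrat, Matrix.smul_vecMul,
      vecHeight_smul_algebraMap (isHeightFinite_principalVec_vecMul (hrow0 _) g)]
  -- conclude
  have hfin := finite_setOf_vecHeight_ratVec_vecMul_le E (m := 1) g T⁻¹
  refine (hfin.preimage hinj.injOn).subset fun q hq => ?_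
  simp only [Set.mem_preimage, Set.mem_setOf_eq] at hq ⊢
  rw [hH q]
  exact (inv_le_inv₀ (lt_trans hT hq) hT).2 hq.le

section DeltaSum

variable [MeasurableSpace (adelicUnipotent F E c 2)]

/-- **The pseudo-Eisenstein sum of the constant-term tail is a finite sum** (`U(J₂)`): for `T > 0`, every `φ`,
`ν`, `𝓕` and `g`, the family `δ ↦ c_B^T φ(δ g)` on `B(F)\G(F)` has finite support (it vanishes unless
`H(δ g) > T`). [cite: Garrett2018, §2.10 (PDF p. 119)] -/
theorem finite_support_constantTermTail_translate_two (ν : Measure (adelicUnipotent F E c 2))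
    (𝓕 : Set (adelicUnipotent F E c 2)) {T : ℝ≥0} (hT : 0 < T) (φ : (quasiSplit F E c 2).Adelic → ℂ)
    (g : (quasiSplit F E c 2).Adelic) :
    (Function.support fun q : Quotient (QuotientGroup.rightRel (arithmeticBorel F E c 2)) =>
      constantTermTail ν 𝓕 T φ
        (((q.out : (quasiSplit F E c 2).arithmeticSubgroup) : (quasiSplit F E c 2).Adelic) * g)).Finite := by
  refine (finite_setOf_lt_borelHeight_two g hT).subset fun q hq => ?_
  by_contra hlt
  exact hq (constantTermTail_of_not_lt φ hlt)

/-- **The `δ`-sum in `k^T(x)` is a finite sum** (`U(J₂)`): for `T > 0`, every `f`, `ν`, `𝓕` and `x`, the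
family `δ ↦ 1_{H(δ x) > T} K_B(δ x, δ x)` on `B(F)\G(F)` has finite support (Rogawski (1990), §2.2 p. 13: «The
sums over `δ` … are finite»). [cite: Rogawski1990, §2.2 (p. 13)] -/
theorem finite_support_kernelBorelTail_translate_two (ν : Measure (adelicUnipotent F E c 2))
    (𝓕 : Set (adelicUnipotent F E c 2)) {T : ℝ≥0} (hT : 0 < T) (f : (quasiSplit F E c 2).Adelic → ℂ)
    (x : (quasiSplit F E c 2).Adelic) :
    (Function.support fun q : Quotient (QuotientGroup.rightRel (arithmeticBorel F E c 2)) =>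
      kernelBorelTail ν 𝓕 T f
        (((q.out : (quasiSplit F E c 2).arithmeticSubgroup) : (quasiSplit F E c 2).Adelic) * x)).Finite := by
  refine (finite_setOf_lt_borelHeight_two x hT).subset fun q hq => ?_
  by_contra hlt
  exact hq (kernelBorelTail_of_not_lt f hlt)

/-- **`Λ^T φ(g) = φ(g) − Σ_{δ ∈ S} c_B^T φ(δ g)`, a genuine finite sum** over the finite support `S` (`U(J₂)`,
`T > 0`; the `finsum` of ★ `truncation` is never junk in two variables). [cite: Garrett2018, §2.10 (PDF p. 119)] -/
theorem truncation_eq_sub_sum_two (ν : Measure (adelicUnipotent F E c 2)) (𝓕 : Set (adelicUnipotent F E c 2))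
    {T : ℝ≥0} (hT : 0 < T) (φ : (quasiSplit F E c 2).Adelic → ℂ) (g : (quasiSplit F E c 2).Adelic) :
    truncation ν 𝓕 T φ g = φ g -
      ∑ q ∈ (finite_support_constantTermTail_translate_two ν 𝓕 hT φ g).toFinset,
        constantTermTail ν 𝓕 T φ
          (((q.out : (quasiSplit F E c 2).arithmeticSubgroup) : (quasiSplit F E c 2).Adelic) * g) := by
  rw [truncation_def, pseudoEisenstein_def,
    finsum_eq_sum _ (finite_support_constantTermTail_translate_two ν 𝓕 hT φ g)]

/-- **`k^T(x) = K(x, x) − Σ_{δ ∈ S} 1_{H(δx) > T} K_B(δ x, δ x)`, a genuine finite sum** over the finite support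
`S` (`U(J₂)`, `T > 0`; the `finsum` of ★ `truncatedKernel` is never junk in two variables).
[cite: Rogawski1990, §2.2 (p. 13)] -/
theorem truncatedKernel_eq_sub_sum_two (ν : Measure (adelicUnipotent F E c 2))
    (𝓕 : Set (adelicUnipotent F E c 2)) {T : ℝ≥0} (hT : 0 < T) (f : (quasiSplit F E c 2).Adelic → ℂ)
    (x : (quasiSplit F E c 2).Adelic) :
    truncatedKernel ν 𝓕 T f x = kernel f x x -
      ∑ q ∈ (finite_support_kernelBorelTail_translate_two ν 𝓕 hT f x).toFinset,
        kernelBorelTail ν 𝓕 T f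
          (((q.out : (quasiSplit F E c 2).arithmeticSubgroup) : (quasiSplit F E c 2).Adelic) * x) := by
  rw [truncatedKernel_def, pseudoEisenstein_def,
    finsum_eq_sum _ (finite_support_kernelBorelTail_translate_two ν 𝓕 hT f x)]

end DeltaSum

end UnitaryGroup

end Literature.NumberTheory.Automorphic
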